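import Summits.QuantumFields.YangMills.Theorems.VirialFluxGapEulerDefectInequality
import Summits.QuantumFields.YangMills.Theorems.VirialFluxGapCentralSlotReading
import HarnessLib

/-!
# Route `VirialFluxGap` (YangMills): THE PER-TERM DRIVE INEQUALITIES OF THE EXPLICIT CENTRAL FIELD (clause (P2) of the central package for
# ⟨stmt-QuantumFields-24141⟩ `PeriodicSoftness`, term by term; free-hands helper)

Width seat `ym-line-sfw-p2-w3` g59 (cell ym-idea-1, free hands), `--supports stmt-QuantumFields-24141`.

The drive of the explicit central field `Y = centralDir σ σ₄ (ringCoord P)` is minus the sum of the insertions of `H = mulTangent Y M` into the terms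
of `ringPoly` (✓`fderiv_ringPoly_apply`; temporal bonds, seam bonds, plaquettes).  This file instantiates the quaternion Euler-defect algebra
(✓`EulerDefect.temporal_euler_le`, ✓`EulerDefect.euler_defect_four_le`) at every term, in the slot letters of w2's ✓`CentralSlotReading`
(`q_v = slotQuat P v`, anchor `c_v = slotQuat (π_C P) v`, sign `slotSign σ σ₄ v`, ✓`centralDir_slot`), on the CENTRAL REGION of a slice-`0`
comb-gauged ring history `P`: `σ_k, σ₄ = ±1`, `σ_k·Re q(w_k) ≥ ½`, `σ₄·Re q(P.2 0) ≥ ½`, `|z_k|², |z₄|² ≤ min(½, ρ²/2)`: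

* §1 slot level: the EFFECTIVE SIGN `s′_v ∈ {±1}` (`= slotSign` at anchored slots, `1` at plain ones), ★ `centralDir_slot_im` — `Y_v = quatMatrix
  (Im(c̄_v q_v) + (s′_v/2)·Im c_v)`, `norm_effSign_anchor_sub_one_le` — `‖s′_v c_v − 1‖ ≤ ρ`, and ★ `four_slot_drive_le` — for any four slots with
  pairwise-equal anchors∕signs on (1,3) and (2,4): `D ≥ 2T − (4r + 3ρ)(3T + 147456·L⁴·F₀)`, `r = 96L²√F₀` (✓`euler_defect_four_le` +
  ✓`norm_slotQuat_sub_centralProj_le`);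
* §2 matrix level, literally the summands of ✓`fderiv_ringPoly_apply` ∕ ✓`ringPoly` at `M = ringCoord P`, `H_v = M_v·Y_v`:
  ★★ `temporal_drive_le` (`D ≥ 2T − 9216L⁴F₀·T`), ★★ `seam_drive_le`, ★★ `plaquette_drive_le` (`D ≥ 2T − (4r + 3ρ)(3T + 147456L⁴F₀)`).

Summation over the terms (F3, w2 g53 'CentralDriveSum') then gives (P2): drive `≥ 2(1 − ε_C)·F₀` with `ε_C = ½(4r + 3ρ)(3 + 147456L⁴·#terms) + 4608L⁴t_C`.

HONEST LABEL: instantiation∕bridging only; the summation and the package are NOT here; ⟨24141⟩ and ⟨22884⟩ stay OPEN; the Yang–Mills mass gap is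
NOT proved by this; no summit is proved by a line.  THEOREMS ONLY (no `def`, no `sorry`).

References: [cite: CosteEtAl1985]; [cite: Luscher1983, §2]; [cite: arXiv220412737, §2 (2.4) (p. 10)].
-/

set_option autoImplicit false

noncomputable section

open scoped Matrix BigOperators Quaternion
open Literature.MathematicalPhysics.QuantumFieldTheory hiding SU2
open Literature.MathematicalPhysics.QuantumLattice

namespace Summit.QuantumFields.YangMills.Theorems.VirialFluxGap.CentralDrive

open Summit.QuantumFields.YangMills.Theorems.FemtoTransferGap
open Summit.QuantumFields.YangMills.Theorems.FemtoTransferGap.TwoLattice.Flat (combFlat combFlat_apply wrapReps)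
open Summit.QuantumFields.YangMills.Theorems.VirialFluxGap.RingDeficit
open Summit.QuantumFields.YangMills.Theorems.VirialFluxGap.FrameDerivative
open Summit.QuantumFields.YangMills.Theorems.VirialFluxGap.FrameHessian
open Summit.QuantumFields.YangMills.Theorems.VirialFluxGap.CentralField
open Summit.QuantumFields.YangMills.Theorems.VirialFluxGap.CentralCoercivity
open Summit.QuantumFields.YangMills.Theorems.VirialFluxGap.CentralSlotReading
open Summit.QuantumFields.YangMills.Theorems.VirialFluxGap.EulerDefect
open Summit.QuantumFields.YangMills.Theorems.ToronValleyVolume.Lojasiewicz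

variable {L : ℕ} [NeZero L]

/-! ## §1 Slot level -/

/-- The anchor sign vanishes exactly at the plain slots, where the anchor is `1`. [cite: CosteEtAl1985] -/
theorem slotQuat_centralProj_eq_one_of_slotSign_eq_zero {σ : Fin 3 → ℝ} (hσ : ∀ k, σ k = 1 ∨ σ k = -1) {σ₄ : ℝ} (hσ₄ : σ₄ = 1 ∨ σ₄ = -1)
    (P : (Fin (2 * L - 1 + 1) → GaugeConfig 3 L SU2) × (Site 3 L → SU2)) {v : (Fin (2 * L - 1 + 1) × Edge 3 L) ⊕ Site 3 L}
    (h0 : slotSign σ σ₄ v = 0) : slotQuat (centralProj L σ σ₄ P) v = 1 := by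
  rcases v with ⟨i, x, k⟩ | y
  · rw [slotSign_inl] at h0
    have hx : ¬ x k = -1 := by
      intro hx; rw [if_pos hx] at h0
      rcases hσ k with h | h <;> rw [h] at h0 <;> norm_num at h0
    rw [slotQuat_centralProj_inl hσ, if_neg hx]
  · rw [slotSign_inr] at h0
    rcases hσ₄ with h | h <;> rw [h] at h0 <;> norm_num at h0

omit [NeZero L] in
/-- The EFFECTIVE SIGN `s′ = (if slotSign = 0 then 1 else slotSign)` is `±1`. [cite: CosteEtAl1985] -/
theorem effSign_eq {σ : Fin 3 → ℝ} (hσ : ∀ k, σ k = 1 ∨ σ k = -1) {σ₄ : ℝ} (hσ₄ : σ₄ = 1 ∨ σ₄ = -1)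
    (v : (Fin (2 * L - 1 + 1) × Edge 3 L) ⊕ Site 3 L) :
    (if slotSign σ σ₄ v = 0 then (1 : ℝ) else slotSign σ σ₄ v) = 1 ∨ (if slotSign σ σ₄ v = 0 then (1 : ℝ) else slotSign σ σ₄ v) = -1 := by
  by_cases h0 : slotSign σ σ₄ v = 0
  · rw [if_pos h0]; exact Or.inl rfl
  · rw [if_neg h0]
    rcases v with ⟨i, x, k⟩ | y
    · rw [slotSign_inl] at h0 ⊢
      by_cases hx : x k = -1
      · rw [if_pos hx]; exact hσ k
      · rw [if_neg hx] at h0; exact absurd rfl h0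
    · rw [slotSign_inr]; exact hσ₄

/-- ★ **The central field at every slot, in anchor letters with the effective sign**:
`Y_v = quatMatrix (Im(c̄_v·q_v) + (s′_v/2)·Im c_v)`. [cite: CosteEtAl1985] -/
theorem centralDir_slot_im {σ : Fin 3 → ℝ} (hσ : ∀ k, σ k = 1 ∨ σ k = -1) {σ₄ : ℝ} (hσ₄ : σ₄ = 1 ∨ σ₄ = -1)
    (P : (Fin (2 * L - 1 + 1) → GaugeConfig 3 L SU2) × (Site 3 L → SU2)) (ht : treeGauge (P.1 0) = 1)
    (hz : ∀ k : Fin 3, (blockIm L (wrapBlock L k) k P 0) ^ 2 + (blockIm L (wrapBlock L k) k P 1) ^ 2 + (blockIm L (wrapBlock L k) k P 2) ^ 2 ≤ 1 / 2)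
    (hz₄ : (seamIm L P 0) ^ 2 + (seamIm L P 1) ^ 2 + (seamIm L P 2) ^ 2 ≤ 1 / 2)
    (v : (Fin (2 * L - 1 + 1) × Edge 3 L) ⊕ Site 3 L) :
    centralDir L σ σ₄ (ringCoord L P) v =
      quatMatrix ((star (slotQuat (centralProj L σ σ₄ P) v) * slotQuat P v).im
        + ((if slotSign σ σ₄ v = 0 then (1 : ℝ) else slotSign σ σ₄ v) / 2) • (slotQuat (centralProj L σ σ₄ P) v).im) := by
  rw [centralDir_slot hσ hσ₄ P ht hz hz₄ v]
  congr 1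
  by_cases h0 : slotSign σ σ₄ v = 0
  · rw [if_pos h0, h0, slotQuat_centralProj_eq_one_of_slotSign_eq_zero hσ hσ₄ P h0]
    ext <;> simp
  · rw [if_neg h0]
    ext <;> simp

/-- ★ **The anchors are `ρ`-close to their sign**: `‖s′_v·c_v − 1‖ ≤ ρ` whenever `2|z_k|² ≤ ρ²` (all `k`), `2|z₄|² ≤ ρ²`, `0 ≤ ρ`. [cite: CosteEtAl1985] -/
theorem norm_effSign_anchor_sub_one_le {σ : Fin 3 → ℝ} (hσ : ∀ k, σ k = 1 ∨ σ k = -1) {σ₄ : ℝ} (hσ₄ : σ₄ = 1 ∨ σ₄ = -1)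
    (P : (Fin (2 * L - 1 + 1) → GaugeConfig 3 L SU2) × (Site 3 L → SU2)) {ρ : ℝ} (hρ : 0 ≤ ρ)
    (hzρ : ∀ k : Fin 3, 2 * ((blockIm L (wrapBlock L k) k P 0) ^ 2 + (blockIm L (wrapBlock L k) k P 1) ^ 2 + (blockIm L (wrapBlock L k) k P 2) ^ 2) ≤ ρ ^ 2)
    (hz₄ρ : 2 * ((seamIm L P 0) ^ 2 + (seamIm L P 1) ^ 2 + (seamIm L P 2) ^ 2) ≤ ρ ^ 2)
    (v : (Fin (2 * L - 1 + 1) × Edge 3 L) ⊕ Site 3 L) :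
    ‖(if slotSign σ σ₄ v = 0 then (1 : ℝ) else slotSign σ σ₄ v) • slotQuat (centralProj L σ σ₄ P) v - 1‖ ≤ ρ := by
  by_cases h0 : slotSign σ σ₄ v = 0
  · rw [if_pos h0, slotQuat_centralProj_eq_one_of_slotSign_eq_zero hσ hσ₄ P h0, one_smul, sub_self, norm_zero]; exact hρ
  rw [if_neg h0]
  refine (abs_le_of_sq_le_sq' ?_ hρ).2
  rcases v with ⟨i, x, k⟩ | y
  · rw [slotSign_inl] at h0 ⊢
    by_cases hx : x k = -1
    · rw [if_pos hx, slotQuat_centralProj_inl hσ, if_pos hx]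
      exact (norm_sq_smul_liftQuat_sub_one_le (hσ k) (normSq_blockIm_le_one _ k P)).trans (hzρ k)
    · rw [if_neg hx] at h0; exact absurd rfl h0
  · rw [slotSign_inr, slotQuat_centralProj_inr σ hσ₄]
    exact (norm_sq_smul_liftQuat_sub_one_le hσ₄ (normSq_seamIm_le_one P)).trans hz₄ρ

/-- ★★ **The four-slot drive inequality in slot letters.**  For four ring variables `v₁, …, v₄` whose anchors and signs agree on the pairs `(1,3)`
and `(2,4)` (parallel links ∕ the two seam sites), with `q_j = slotQuat P v_j`, directions `A_j = Im(c̄_j q_j) + (s′_j/2)·Im c_j`, word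
`T = 2 − 2Re(q₁q₂q̄₃q̄₄)` and drive `D = −2Re(q₁A₁q₂q̄₃q̄₄ + q₁q₂A₂q̄₃q̄₄ − q₁q₂A₃q̄₃q̄₄ − q₁q₂q̄₃A₄q̄₄)`:
`D ≥ 2T − (4r + 3ρ)·(3T + 147456·L⁴·F₀(P))`, `r = 96L²√F₀(P)`. [cite: CosteEtAl1985] -/
theorem four_slot_drive_le {σ : Fin 3 → ℝ} (hσ : ∀ k, σ k = 1 ∨ σ k = -1) {σ₄ : ℝ} (hσ₄ : σ₄ = 1 ∨ σ₄ = -1)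
    (P : (Fin (2 * L - 1 + 1) → GaugeConfig 3 L SU2) × (Site 3 L → SU2)) (ht : treeGauge (P.1 0) = 1)
    (hW : ∀ k : Fin 3, (1 / 2 : ℝ) ≤ σ k * (su2Quat (wrapReps (P.1 0) k)).re) (hS : (1 / 2 : ℝ) ≤ σ₄ * (su2Quat (P.2 0)).re)
    {ρ : ℝ} (hρ : 0 ≤ ρ)
    (hzρ : ∀ k : Fin 3, 2 * ((blockIm L (wrapBlock L k) k P 0) ^ 2 + (blockIm L (wrapBlock L k) k P 1) ^ 2 + (blockIm L (wrapBlock L k) k P 2) ^ 2) ≤ ρ ^ 2)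
    (hz₄ρ : 2 * ((seamIm L P 0) ^ 2 + (seamIm L P 1) ^ 2 + (seamIm L P 2) ^ 2) ≤ ρ ^ 2)
    (v₁ v₂ v₃ v₄ : (Fin (2 * L - 1 + 1) × Edge 3 L) ⊕ Site 3 L)
    (ha₁₃ : slotQuat (centralProj L σ σ₄ P) v₃ = slotQuat (centralProj L σ σ₄ P) v₁) (hs₁₃ : slotSign σ σ₄ v₃ = slotSign σ σ₄ v₁)
    (ha₂₄ : slotQuat (centralProj L σ σ₄ P) v₄ = slotQuat (centralProj L σ σ₄ P) v₂) (hs₂₄ : slotSign σ σ₄ v₄ = slotSign σ σ₄ v₂)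
    {A₁ A₂ A₃ A₄ : ℍ}
    (hA₁ : A₁ = (star (slotQuat (centralProj L σ σ₄ P) v₁) * slotQuat P v₁).im
        + ((if slotSign σ σ₄ v₁ = 0 then (1 : ℝ) else slotSign σ σ₄ v₁) / 2) • (slotQuat (centralProj L σ σ₄ P) v₁).im)
    (hA₂ : A₂ = (star (slotQuat (centralProj L σ σ₄ P) v₂) * slotQuat P v₂).im
        + ((if slotSign σ σ₄ v₂ = 0 then (1 : ℝ) else slotSign σ σ₄ v₂) / 2) • (slotQuat (centralProj L σ σ₄ P) v₂).im)
    (hA₃ : A₃ = (star (slotQuat (centralProj L σ σ₄ P) v₃) * slotQuat P v₃).im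
        + ((if slotSign σ σ₄ v₃ = 0 then (1 : ℝ) else slotSign σ σ₄ v₃) / 2) • (slotQuat (centralProj L σ σ₄ P) v₃).im)
    (hA₄ : A₄ = (star (slotQuat (centralProj L σ σ₄ P) v₄) * slotQuat P v₄).im
        + ((if slotSign σ σ₄ v₄ = 0 then (1 : ℝ) else slotSign σ σ₄ v₄) / 2) • (slotQuat (centralProj L σ σ₄ P) v₄).im) :
    2 * (2 - 2 * (slotQuat P v₁ * slotQuat P v₂ * star (slotQuat P v₃) * star (slotQuat P v₄)).re)
        - (4 * (96 * (L : ℝ) ^ 2 * Real.sqrt (ringDeficit L (fun _ => false) P)) + 3 * ρ)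
          * (3 * (2 - 2 * (slotQuat P v₁ * slotQuat P v₂ * star (slotQuat P v₃) * star (slotQuat P v₄)).re)
            + 147456 * (L : ℝ) ^ 4 * ringDeficit L (fun _ => false) P)
      ≤ -2 * (slotQuat P v₁ * A₁ * slotQuat P v₂ * star (slotQuat P v₃) * star (slotQuat P v₄)
              + slotQuat P v₁ * slotQuat P v₂ * A₂ * star (slotQuat P v₃) * star (slotQuat P v₄)
              - slotQuat P v₁ * slotQuat P v₂ * A₃ * star (slotQuat P v₃) * star (slotQuat P v₄)
              - slotQuat P v₁ * slotQuat P v₂ * star (slotQuat P v₃) * A₄ * star (slotQuat P v₄)).re := by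
  rw [ha₁₃, hs₁₃] at hA₃
  rw [ha₂₄, hs₂₄] at hA₄
  have hr := fun v => norm_slotQuat_sub_centralProj_le P ht hσ hσ₄ hW hS v
  have hr₃ := hr v₃; rw [ha₁₃] at hr₃
  have hr₄ := hr v₄; rw [ha₂₄] at hr₄
  have h := euler_defect_four_le (norm_slotQuat P v₁) (norm_slotQuat P v₂) (norm_slotQuat P v₃) (norm_slotQuat P v₄)
    (norm_slotQuat (centralProj L σ σ₄ P) v₁) (norm_slotQuat (centralProj L σ σ₄ P) v₂) (effSign_eq hσ hσ₄ v₁) (effSign_eq hσ hσ₄ v₂)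
    hA₁ hA₂ hA₃ hA₄ (hr v₁) (hr v₂) hr₃ hr₄ (norm_effSign_anchor_sub_one_le hσ hσ₄ P hρ hzρ hz₄ρ v₁)
    (norm_effSign_anchor_sub_one_le hσ hσ₄ P hρ hzρ hz₄ρ v₂)
  -- the proximity squares are ≤ 9216 L⁴ F₀ each
  have hY := fun v => norm_sq_slotQuat_sub_centralProj_le P ht hσ hσ₄ hW hS v
  have hY₃ := hY v₃; rw [ha₁₃] at hY₃
  have hY₄ := hY v₄; rw [ha₂₄] at hY₄
  have hK : 0 ≤ 4 * (96 * (L : ℝ) ^ 2 * Real.sqrt (ringDeficit L (fun _ => false) P)) + 3 * ρ := by positivity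
  have hmono := mul_le_mul_of_nonneg_left (add_le_add (add_le_add (add_le_add (hY v₁) (hY v₂)) hY₃) hY₄) hK
  linarith [hmono]

/-! ## §2 Matrix level: the summands of `fderiv_ringPoly_apply` at `M = ringCoord P`, `H_v = M_v·Y_v` -/

/-- A slice link of a ring history in quaternion letters: `(ringCoord P).1 i e = quatMatrix (slotQuat P (i,e))`. [folklore] -/
theorem ringCoord_fst_eq (P : (Fin (2 * L - 1 + 1) → GaugeConfig 3 L SU2) × (Site 3 L → SU2)) (i : Fin (2 * L - 1 + 1)) (e : Edge 3 L) :
    (ringCoord L P).1 i e = quatMatrix (slotQuat P (Sum.inl (i, e))) := by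
  rw [slotQuat_inl, quatMatrix_su2Quat]; rfl

/-- A seam site of a ring history in quaternion letters. [folklore] -/
theorem ringCoord_snd_eq (P : (Fin (2 * L - 1 + 1) → GaugeConfig 3 L SU2) × (Site 3 L → SU2)) (x : Site 3 L) :
    (ringCoord L P).2 x = quatMatrix (slotQuat P (Sum.inr x)) := by
  rw [slotQuat_inr, quatMatrix_su2Quat]; rfl

omit [NeZero L] in
/-- The slot directions are pure: `star A = −A` for `A = Im x + t·Im y`. [folklore] -/
theorem star_im_add_smul_im (x y : ℍ) (t : ℝ) : star (x.im + t • y.im) = -(x.im + t • y.im) := by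
  ext <;> simp <;> ring

omit [NeZero L] in
/-- Shifting a site in direction `ν` does not change its `μ`-coordinate, `μ ≠ ν`. [folklore] -/
theorem shift_apply_of_ne (x : Site 3 L) {μ ν : Fin 3} (h : μ ≠ ν) : (x.shift ν) μ = x μ := by
  simp only [Site.shift, Pi.add_apply, Pi.single_eq_of_ne h, add_zero]

/-- ★★ **The temporal-bond drive inequality**, literally the temporal summand of ✓`fderiv_ringPoly_apply` at `M = ringCoord P`, `H_v = M_v·Y_v`,
`Y = centralDir σ σ₄ M`: `D ≥ 2T − 9216·L⁴·F₀(P)·T`. [cite: CosteEtAl1985] -/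
theorem temporal_drive_le {σ : Fin 3 → ℝ} (hσ : ∀ k, σ k = 1 ∨ σ k = -1) {σ₄ : ℝ} (hσ₄ : σ₄ = 1 ∨ σ₄ = -1)
    (P : (Fin (2 * L - 1 + 1) → GaugeConfig 3 L SU2) × (Site 3 L → SU2)) (ht : treeGauge (P.1 0) = 1)
    (hW : ∀ k : Fin 3, (1 / 2 : ℝ) ≤ σ k * (su2Quat (wrapReps (P.1 0) k)).re) (hS : (1 / 2 : ℝ) ≤ σ₄ * (su2Quat (P.2 0)).re)
    (hz : ∀ k : Fin 3, (blockIm L (wrapBlock L k) k P 0) ^ 2 + (blockIm L (wrapBlock L k) k P 1) ^ 2 + (blockIm L (wrapBlock L k) k P 2) ^ 2 ≤ 1 / 2)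
    (hz₄ : (seamIm L P 0) ^ 2 + (seamIm L P 1) ^ 2 + (seamIm L P 2) ^ 2 ≤ 1 / 2)
    (i : Fin (2 * L - 1)) (e : Edge 3 L) :
    2 * (2 - (((ringCoord L P).1 i.castSucc e * ((ringCoord L P).1 i.succ e)ᴴ).trace).re)
        - 9216 * (L : ℝ) ^ 4 * ringDeficit L (fun _ => false) P * (2 - (((ringCoord L P).1 i.castSucc e * ((ringCoord L P).1 i.succ e)ᴴ).trace).re)
      ≤ -(((ringCoord L P).1 i.castSucc e * centralDir L σ σ₄ (ringCoord L P) (Sum.inl (i.castSucc, e)) * ((ringCoord L P).1 i.succ e)ᴴ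
            + (ringCoord L P).1 i.castSucc e * ((ringCoord L P).1 i.succ e * centralDir L σ σ₄ (ringCoord L P) (Sum.inl (i.succ, e)))ᴴ).trace).re := by
  rw [centralDir_slot_im hσ hσ₄ P ht hz hz₄ (Sum.inl (i.castSucc, e)), centralDir_slot_im hσ hσ₄ P ht hz hz₄ (Sum.inl (i.succ, e)),
    ringCoord_fst_eq P i.castSucc e, ringCoord_fst_eq P i.succ e]
  set q := slotQuat P (Sum.inl (i.castSucc, e)) with hq
  set q' := slotQuat P (Sum.inl (i.succ, e)) with hq'
  rw [slotQuat_centralProj_slice σ σ₄ P i.succ i.castSucc e, slotSign_slice σ σ₄ i.succ i.castSucc e]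
  set c := slotQuat (centralProj L σ σ₄ P) (Sum.inl (i.castSucc, e)) with hc
  set b := ((if slotSign σ σ₄ (Sum.inl (i.castSucc, e) : (Fin (2 * L - 1 + 1) × Edge 3 L) ⊕ Site 3 L) = 0 then (1 : ℝ)
    else slotSign σ σ₄ (Sum.inl (i.castSucc, e))) / 2) • c.im with hb
  simp only [← Literature.Geometry.GaugeTheory.quatMatrix_star, ← quatMatrix_mul, ← Literature.Geometry.GaugeTheory.quatMatrix_add,
    trace_quatMatrix_re]
  have hpure : star ((star c * q').im + b) = -((star c * q').im + b) := by rw [hb]; exact star_im_add_smul_im _ _ _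
  have e1 : (q * ((star c * q).im + b) * star q' + q * star (q' * ((star c * q').im + b))).re
      = (q * (((star c * q).im + b) - ((star c * q').im + b)) * star q').re := by
    rw [star_mul, hpure]; congr 1; noncomm_ring
  rw [e1]
  have hr := norm_slotQuat_sub_centralProj_le P ht hσ hσ₄ hW hS
  have hr' := hr (Sum.inl (i.succ, e)); rw [slotQuat_centralProj_slice σ σ₄ P i.succ i.castSucc e] at hr'
  have h := (temporal_euler_le (norm_slotQuat P _) (norm_slotQuat P _) (norm_slotQuat (centralProj L σ σ₄ P) _) b rfl rfl (hr (Sum.inl (i.castSucc, e))) hr').2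
  have hF : 0 ≤ ringDeficit L (fun _ => false) P := ringDeficit_nonneg _ P
  have hsq : (96 * (L : ℝ) ^ 2 * Real.sqrt (ringDeficit L (fun _ => false) P)) ^ 2 = 9216 * (L : ℝ) ^ 4 * ringDeficit L (fun _ => false) P := by
    rw [mul_pow, mul_pow, Real.sq_sqrt hF]; ring
  rw [hsq] at h
  linarith

/-- ★★ **The plaquette drive inequality**, literally the plaquette summand of ✓`fderiv_ringPoly_apply` ∕ ✓`ringPoly` at `M = ringCoord P`,
`H_v = M_v·Y_v`, `Y = centralDir σ σ₄ M`: `D ≥ 2T − (4r + 3ρ)(3T + 147456·L⁴·F₀(P))`, `r = 96L²√F₀(P)`. [cite: CosteEtAl1985] -/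
theorem plaquette_drive_le {σ : Fin 3 → ℝ} (hσ : ∀ k, σ k = 1 ∨ σ k = -1) {σ₄ : ℝ} (hσ₄ : σ₄ = 1 ∨ σ₄ = -1)
    (P : (Fin (2 * L - 1 + 1) → GaugeConfig 3 L SU2) × (Site 3 L → SU2)) (ht : treeGauge (P.1 0) = 1)
    (hW : ∀ k : Fin 3, (1 / 2 : ℝ) ≤ σ k * (su2Quat (wrapReps (P.1 0) k)).re) (hS : (1 / 2 : ℝ) ≤ σ₄ * (su2Quat (P.2 0)).re)
    (hz : ∀ k : Fin 3, (blockIm L (wrapBlock L k) k P 0) ^ 2 + (blockIm L (wrapBlock L k) k P 1) ^ 2 + (blockIm L (wrapBlock L k) k P 2) ^ 2 ≤ 1 / 2)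
    (hz₄ : (seamIm L P 0) ^ 2 + (seamIm L P 1) ^ 2 + (seamIm L P 2) ^ 2 ≤ 1 / 2)
    {ρ : ℝ} (hρ : 0 ≤ ρ)
    (hzρ : ∀ k : Fin 3, 2 * ((blockIm L (wrapBlock L k) k P 0) ^ 2 + (blockIm L (wrapBlock L k) k P 1) ^ 2 + (blockIm L (wrapBlock L k) k P 2) ^ 2) ≤ ρ ^ 2)
    (hz₄ρ : 2 * ((seamIm L P 0) ^ 2 + (seamIm L P 1) ^ 2 + (seamIm L P 2) ^ 2) ≤ ρ ^ 2)
    (j : Fin (2 * L - 1 + 1)) (p : Plaquette 3 L) :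
    2 * (2 - (((ringCoord L P).1 j (p.1, p.2.1.1) * (ringCoord L P).1 j (p.1.shift p.2.1.1, p.2.1.2) * ((ringCoord L P).1 j (p.1.shift p.2.1.2, p.2.1.1))ᴴ * ((ringCoord L P).1 j (p.1, p.2.1.2))ᴴ).trace).re) - (4 * (96 * (L : ℝ) ^ 2 * Real.sqrt (ringDeficit L (fun _ => false) P)) + 3 * ρ) * (3 * (2 - (((ringCoord L P).1 j (p.1, p.2.1.1) * (ringCoord L P).1 j (p.1.shift p.2.1.1, p.2.1.2) * ((ringCoord L P).1 j (p.1.shift p.2.1.2, p.2.1.1))ᴴ * ((ringCoord L P).1 j (p.1, p.2.1.2))ᴴ).trace).re) + 147456 * (L : ℝ) ^ 4 * ringDeficit L (fun _ => false) P)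
      ≤ -(((ringCoord L P).1 j (p.1, p.2.1.1) * centralDir L σ σ₄ (ringCoord L P) (Sum.inl (j, (p.1, p.2.1.1))) * (ringCoord L P).1 j (p.1.shift p.2.1.1, p.2.1.2) * ((ringCoord L P).1 j (p.1.shift p.2.1.2, p.2.1.1))ᴴ * ((ringCoord L P).1 j (p.1, p.2.1.2))ᴴ + (ringCoord L P).1 j (p.1, p.2.1.1) * ((ringCoord L P).1 j (p.1.shift p.2.1.1, p.2.1.2) * centralDir L σ σ₄ (ringCoord L P) (Sum.inl (j, (p.1.shift p.2.1.1, p.2.1.2)))) * ((ringCoord L P).1 j (p.1.shift p.2.1.2, p.2.1.1))ᴴ * ((ringCoord L P).1 j (p.1, p.2.1.2))ᴴ + (ringCoord L P).1 j (p.1, p.2.1.1) * (ringCoord L P).1 j (p.1.shift p.2.1.1, p.2.1.2) * ((ringCoord L P).1 j (p.1.shift p.2.1.2, p.2.1.1) * centralDir L σ σ₄ (ringCoord L P) (Sum.inl (j, (p.1.shift p.2.1.2, p.2.1.1))))ᴴ * ((ringCoord L P).1 j (p.1, p.2.1.2))ᴴ + (ringCoord L P).1 j (p.1, p.2.1.1)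 * (ringCoord L P).1 j (p.1.shift p.2.1.1, p.2.1.2) * ((ringCoord L P).1 j (p.1.shift p.2.1.2, p.2.1.1))ᴴ * ((ringCoord L P).1 j (p.1, p.2.1.2) * centralDir L σ σ₄ (ringCoord L P) (Sum.inl (j, (p.1, p.2.1.2))))ᴴ).trace).re := by
  have hμν : p.2.1.1 ≠ p.2.1.2 := ne_of_lt p.2.2
  have h13 : (p.1.shift p.2.1.2) p.2.1.1 = p.1 p.2.1.1 := shift_apply_of_ne p.1 hμν
  have h24 : p.1 p.2.1.2 = (p.1.shift p.2.1.1) p.2.1.2 := (shift_apply_of_ne p.1 (Ne.symm hμν)).symm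
  have ha₁₃ := slotQuat_centralProj_parallel σ σ₄ P j j p.2.1.1 h13
  have hs₁₃ := slotSign_parallel σ σ₄ j j p.2.1.1 h13
  have ha₂₄ := slotQuat_centralProj_parallel σ σ₄ P j j p.2.1.2 h24
  have hs₂₄ := slotSign_parallel σ σ₄ j j p.2.1.2 h24
  have h4 := four_slot_drive_le hσ hσ₄ P ht hW hS hρ hzρ hz₄ρ (Sum.inl (j, (p.1, p.2.1.1))) (Sum.inl (j, (p.1.shift p.2.1.1, p.2.1.2))) (Sum.inl (j, (p.1.shift p.2.1.2, p.2.1.1))) (Sum.inl (j, (p.1, p.2.1.2)))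
    ha₁₃ hs₁₃ ha₂₄ hs₂₄ rfl rfl rfl rfl
  rw [centralDir_slot_im hσ hσ₄ P ht hz hz₄ (Sum.inl (j, (p.1, p.2.1.1))), centralDir_slot_im hσ hσ₄ P ht hz hz₄ (Sum.inl (j, (p.1.shift p.2.1.1, p.2.1.2))),
    centralDir_slot_im hσ hσ₄ P ht hz hz₄ (Sum.inl (j, (p.1.shift p.2.1.2, p.2.1.1))), centralDir_slot_im hσ hσ₄ P ht hz hz₄ (Sum.inl (j, (p.1, p.2.1.2))),
    ringCoord_fst_eq P j (p.1, p.2.1.1), ringCoord_fst_eq P j (p.1.shift p.2.1.1, p.2.1.2), ringCoord_fst_eq P j (p.1.shift p.2.1.2, p.2.1.1), ringCoord_fst_eq P j (p.1, p.2.1.2)]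
  set q₁ := slotQuat P (Sum.inl (j, (p.1, p.2.1.1)))
  set q₂ := slotQuat P (Sum.inl (j, (p.1.shift p.2.1.1, p.2.1.2)))
  set q₃ := slotQuat P (Sum.inl (j, (p.1.shift p.2.1.2, p.2.1.1)))
  set q₄ := slotQuat P (Sum.inl (j, (p.1, p.2.1.2)))
  set A₁ := ((star (slotQuat (centralProj L σ σ₄ P) (Sum.inl (j, (p.1, p.2.1.1)))) * slotQuat P (Sum.inl (j, (p.1, p.2.1.1)))).im + ((if slotSign σ σ₄ (Sum.inl (j, (p.1, p.2.1.1))) = 0 then (1 : ℝ) else slotSign σ σ₄ (Sum.inl (j, (p.1, p.2.1.1)))) / 2) • (slotQuat (centralProj L σ σ₄ P) (Sum.inl (j, (p.1, p.2.1.1)))).im)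
  set A₂ := ((star (slotQuat (centralProj L σ σ₄ P) (Sum.inl (j, (p.1.shift p.2.1.1, p.2.1.2)))) * slotQuat P (Sum.inl (j, (p.1.shift p.2.1.1, p.2.1.2)))).im + ((if slotSign σ σ₄ (Sum.inl (j, (p.1.shift p.2.1.1, p.2.1.2))) = 0 then (1 : ℝ) else slotSign σ σ₄ (Sum.inl (j, (p.1.shift p.2.1.1, p.2.1.2)))) / 2) • (slotQuat (centralProj L σ σ₄ P) (Sum.inl (j, (p.1.shift p.2.1.1, p.2.1.2)))).im)
  set A₃ := ((star (slotQuat (centralProj L σ σ₄ P) (Sum.inl (j, (p.1.shift p.2.1.2, p.2.1.1)))) * slotQuat P (Sum.inl (j, (p.1.shift p.2.1.2, p.2.1.1)))).im + ((if slotSign σ σ₄ (Sum.inl (j, (p.1.shift p.2.1.2, p.2.1.1))) = 0 then (1 : ℝ) else slotSign σ σ₄ (Sum.inl (j, (p.1.shift p.2.1.2, p.2.1.1)))) / 2) • (slotQuat (centralProj L σ σ₄ P) (Sum.inl (j, (p.1.shift p.2.1.2, p.2.1.1)))).im) with hA₃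
  set A₄ := ((star (slotQuat (centralProj L σ σ₄ P) (Sum.inl (j, (p.1, p.2.1.2)))) * slotQuat P (Sum.inl (j, (p.1, p.2.1.2)))).im + ((if slotSign σ σ₄ (Sum.inl (j, (p.1, p.2.1.2))) = 0 then (1 : ℝ) else slotSign σ σ₄ (Sum.inl (j, (p.1, p.2.1.2)))) / 2) • (slotQuat (centralProj L σ σ₄ P) (Sum.inl (j, (p.1, p.2.1.2)))).im) with hA₄
  have hp₃ : star A₃ = -A₃ := by rw [hA₃]; exact star_im_add_smul_im _ _ _
  have hp₄ : star A₄ = -A₄ := by rw [hA₄]; exact star_im_add_smul_im _ _ _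
  simp only [← Literature.Geometry.GaugeTheory.quatMatrix_star, ← quatMatrix_mul, ← Literature.Geometry.GaugeTheory.quatMatrix_add,
    trace_quatMatrix_re]
  have e1 : (q₁ * A₁ * q₂ * star q₃ * star q₄ + q₁ * (q₂ * A₂) * star q₃ * star q₄ + q₁ * q₂ * star (q₃ * A₃) * star q₄
        + q₁ * q₂ * star q₃ * star (q₄ * A₄)).re
      = (q₁ * A₁ * q₂ * star q₃ * star q₄ + q₁ * q₂ * A₂ * star q₃ * star q₄ - q₁ * q₂ * A₃ * star q₃ * star q₄
        - q₁ * q₂ * star q₃ * A₄ * star q₄).re := by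
    rw [star_mul, star_mul, hp₃, hp₄]; congr 1; noncomm_ring
  rw [e1]
  linarith [h4]

/-- ★★ **The seam-bond drive inequality**, literally the seam summand of ✓`fderiv_ringPoly_apply` ∕ ✓`ringPoly` at `M = ringCoord P`,
`H_v = M_v·Y_v`, `Y = centralDir σ σ₄ M` (slots `(U_last(e), S(x+k), U_0(e), S(x))`): `D ≥ 2T − (4r + 3ρ)(3T + 147456·L⁴·F₀(P))`.
[cite: CosteEtAl1985] -/
theorem seam_drive_le {σ : Fin 3 → ℝ} (hσ : ∀ k, σ k = 1 ∨ σ k = -1) {σ₄ : ℝ} (hσ₄ : σ₄ = 1 ∨ σ₄ = -1)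
    (P : (Fin (2 * L - 1 + 1) → GaugeConfig 3 L SU2) × (Site 3 L → SU2)) (ht : treeGauge (P.1 0) = 1)
    (hW : ∀ k : Fin 3, (1 / 2 : ℝ) ≤ σ k * (su2Quat (wrapReps (P.1 0) k)).re) (hS : (1 / 2 : ℝ) ≤ σ₄ * (su2Quat (P.2 0)).re)
    (hz : ∀ k : Fin 3, (blockIm L (wrapBlock L k) k P 0) ^ 2 + (blockIm L (wrapBlock L k) k P 1) ^ 2 + (blockIm L (wrapBlock L k) k P 2) ^ 2 ≤ 1 / 2)
    (hz₄ : (seamIm L P 0) ^ 2 + (seamIm L P 1) ^ 2 + (seamIm L P 2) ^ 2 ≤ 1 / 2)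
    {ρ : ℝ} (hρ : 0 ≤ ρ)
    (hzρ : ∀ k : Fin 3, 2 * ((blockIm L (wrapBlock L k) k P 0) ^ 2 + (blockIm L (wrapBlock L k) k P 1) ^ 2 + (blockIm L (wrapBlock L k) k P 2) ^ 2) ≤ ρ ^ 2)
    (hz₄ρ : 2 * ((seamIm L P 0) ^ 2 + (seamIm L P 1) ^ 2 + (seamIm L P 2) ^ 2) ≤ ρ ^ 2)
    (e : Edge 3 L) :
    2 * (2 - (((ringCoord L P).1 (Fin.last (2 * L - 1)) e * ((ringCoord L P).2 e.1 * (ringCoord L P).1 0 e * ((ringCoord L P).2 (e.1.shift e.2))ᴴ)ᴴ).trace).re) - (4 * (96 * (L : ℝ) ^ 2 * Real.sqrt (ringDeficit L (fun _ => false) P)) + 3 * ρ) * (3 * (2 - (((ringCoord L P).1 (Fin.last (2 * L - 1)) e * ((ringCoord L P).2 e.1 * (ringCoord L P).1 0 e * ((ringCoord L P).2 (e.1.shift e.2))ᴴ)ᴴ).trace).re) + 147456 * (L : ℝ) ^ 4 * ringDeficit L (fun _ => false) P)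
      ≤ -(((ringCoord L P).1 (Fin.last (2 * L - 1)) e * centralDir L σ σ₄ (ringCoord L P) (Sum.inl ((Fin.last (2 * L - 1)), e)) * ((ringCoord L P).2 e.1 * (ringCoord L P).1 0 e * ((ringCoord L P).2 (e.1.shift e.2))ᴴ)ᴴ + (ringCoord L P).1 (Fin.last (2 * L - 1)) e * ((ringCoord L P).2 e.1 * centralDir L σ σ₄ (ringCoord L P) (Sum.inr e.1) * (ringCoord L P).1 0 e * ((ringCoord L P).2 (e.1.shift e.2))ᴴ + (ringCoord L P).2 e.1 * ((ringCoord L P).1 0 e * centralDir L σ σ₄ (ringCoord L P) (Sum.inl (0, e))) * ((ringCoord L P).2 (e.1.shift e.2))ᴴ + (ringCoord L P).2 e.1 * (ringCoord L P).1 0 e * ((ringCoord L P).2 (e.1.shift e.2) * centralDir L σ σ₄ (ringCoord L P) (Sum.inr (e.1.shift e.2)))ᴴ)ᴴ).trace).re := by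
  have ha₁₃ := slotQuat_centralProj_slice σ σ₄ P 0 (Fin.last (2 * L - 1)) e
  have hs₁₃ := slotSign_slice σ σ₄ (0 : Fin (2 * L - 1 + 1)) (Fin.last (2 * L - 1)) e
  have ha₂₄ := slotQuat_centralProj_seam σ σ₄ P e.1 (e.1.shift e.2)
  have hs₂₄ : slotSign σ σ₄ (Sum.inr e.1 : (Fin (2 * L - 1 + 1) × Edge 3 L) ⊕ Site 3 L) = slotSign σ σ₄ (Sum.inr (e.1.shift e.2)) := by
    rw [slotSign_inr, slotSign_inr]
  have h4 := four_slot_drive_le hσ hσ₄ P ht hW hS hρ hzρ hz₄ρ (Sum.inl ((Fin.last (2 * L - 1)), e)) (Sum.inr (e.1.shift e.2)) (Sum.inl (0, e)) (Sum.inr e.1)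
    ha₁₃ hs₁₃ ha₂₄ hs₂₄ rfl rfl rfl rfl
  rw [centralDir_slot_im hσ hσ₄ P ht hz hz₄ (Sum.inl ((Fin.last (2 * L - 1)), e)), centralDir_slot_im hσ hσ₄ P ht hz hz₄ (Sum.inr (e.1.shift e.2)),
    centralDir_slot_im hσ hσ₄ P ht hz hz₄ (Sum.inl (0, e)), centralDir_slot_im hσ hσ₄ P ht hz hz₄ (Sum.inr e.1),
    ringCoord_fst_eq P (Fin.last (2 * L - 1)) e, ringCoord_fst_eq P 0 e, ringCoord_snd_eq P e.1, ringCoord_snd_eq P (e.1.shift e.2)]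
  set q₁ := slotQuat P (Sum.inl ((Fin.last (2 * L - 1)), e))
  set q₂ := slotQuat P (Sum.inr (e.1.shift e.2))
  set q₃ := slotQuat P (Sum.inl (0, e))
  set q₄ := slotQuat P (Sum.inr e.1)
  set A₁ := ((star (slotQuat (centralProj L σ σ₄ P) (Sum.inl ((Fin.last (2 * L - 1)), e))) * slotQuat P (Sum.inl ((Fin.last (2 * L - 1)), e))).im + ((if slotSign σ σ₄ (Sum.inl ((Fin.last (2 * L - 1)), e)) = 0 then (1 : ℝ) else slotSign σ σ₄ (Sum.inl ((Fin.last (2 * L - 1)), e))) / 2) • (slotQuat (centralProj L σ σ₄ P) (Sum.inl ((Fin.last (2 * L - 1)), e))).im)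
  set A₂ := ((star (slotQuat (centralProj L σ σ₄ P) (Sum.inr (e.1.shift e.2))) * slotQuat P (Sum.inr (e.1.shift e.2))).im + ((if slotSign σ σ₄ (Sum.inr (e.1.shift e.2)) = 0 then (1 : ℝ) else slotSign σ σ₄ (Sum.inr (e.1.shift e.2))) / 2) • (slotQuat (centralProj L σ σ₄ P) (Sum.inr (e.1.shift e.2))).im) with hA₂
  set A₃ := ((star (slotQuat (centralProj L σ σ₄ P) (Sum.inl (0, e))) * slotQuat P (Sum.inl (0, e))).im + ((if slotSign σ σ₄ (Sum.inl (0, e)) = 0 then (1 : ℝ) else slotSign σ σ₄ (Sum.inl (0, e))) / 2) • (slotQuat (centralProj L σ σ₄ P) (Sum.inl (0, e))).im) with hA₃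
  set A₄ := ((star (slotQuat (centralProj L σ σ₄ P) (Sum.inr e.1)) * slotQuat P (Sum.inr e.1)).im + ((if slotSign σ σ₄ (Sum.inr e.1) = 0 then (1 : ℝ) else slotSign σ σ₄ (Sum.inr e.1)) / 2) • (slotQuat (centralProj L σ σ₄ P) (Sum.inr e.1)).im) with hA₄
  have hp₂ : star A₂ = -A₂ := by rw [hA₂]; exact star_im_add_smul_im _ _ _
  have hp₃ : star A₃ = -A₃ := by rw [hA₃]; exact star_im_add_smul_im _ _ _
  have hp₄ : star A₄ = -A₄ := by rw [hA₄]; exact star_im_add_smul_im _ _ _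
  simp only [← Literature.Geometry.GaugeTheory.quatMatrix_star, ← quatMatrix_mul, ← Literature.Geometry.GaugeTheory.quatMatrix_add,
    trace_quatMatrix_re]
  have eT : (q₁ * star (q₄ * q₃ * star q₂)).re = (q₁ * q₂ * star q₃ * star q₄).re := by
    rw [star_mul, star_mul, star_star]; congr 1; noncomm_ring
  have eD : (q₁ * A₁ * star (q₄ * q₃ * star q₂) + q₁ * star (q₄ * A₄ * q₃ * star q₂ + q₄ * (q₃ * A₃) * star q₂ + q₄ * q₃ * star (q₂ * A₂))).re
      = (q₁ * A₁ * q₂ * star q₃ * star q₄ + q₁ * q₂ * A₂ * star q₃ * star q₄ - q₁ * q₂ * A₃ * star q₃ * star q₄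
        - q₁ * q₂ * star q₃ * A₄ * star q₄).re := by
    simp only [star_mul, star_add, star_star, star_neg, neg_mul, hp₂, hp₃, hp₄]; congr 1; noncomm_ring
  rw [eT, eD]
  linarith [h4]

end Summit.QuantumFields.YangMills.Theorems.VirialFluxGap.CentralDrive

end
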